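import Summits.Langlands.Langlands.Theorems.IrreducibilityBySelfDualityHeckeEigenvalueFieldStubConeGrowthLeftForm
import HarnessLib

/-!
# Crux `HeckeEigenvalueField` (stmt-Langlands-13632), line `Sketch`, stub GROWTH-ω — part 4:
# the derivative of the cone form through the group, and pointwise bounds on the cone

Helper file (part 4 of 5) for the registered stub `stub_coneForm_growth`.  Theorems only.

1. **`Dω_H` from `Dω̃_g` at `H = g gᴴ`** (`cfg_fderiv_coneForm_apply`): near an invertible `g` the
   left-trivialised form is the pull-back `ω̃(m) = ω(P(m mᴴ)) ∘∧ T(m)` of the cone form `ω` along the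
   hermitian square (`coneForm_apply_tangent` at every invertible `m`; `P` the hermitian projection,
   `T(m) : Y ↦ P(Y mᴴ + m Yᴴ)` its differential); differentiating at `g` (`ω` is differentiable at `H`,
   `differentiableAt_coneForm`), evaluating at the right inverse `R w = ½ w g⁻ᴴ` of `T(g)` and composing
   with `R`: `Dω_H(w) = Dω̃_g(R w) ∘∧ R − ((ω H) ∘' T(g))(T(R w)) ∘∧ R` — no second derivative of a
   local section is needed.
2. **Pointwise bounds** (`stub_coneGrowth_pointwise`): for `t ≥ 1` dominating `‖ω_left(g)‖`, `‖Dω_left(g)‖`,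
   `‖g‖`, `‖g⁻¹‖`, `‖g⁻ᴴ‖` (`g = sec H`), `‖ι‖` and `‖T‖`: `‖ω(H)‖ ≤ t^{3q+4}`,
   `‖Dω(H)‖ ≤ (2q+3) t^{7q+9}`.

[cite: BorelWallach2000, VII 2.2–2.4]
-/

set_option linter.dupNamespace false -- project-wide: `Summit.Langlands.Langlands` is the mandated namespace

noncomputable section

open scoped Matrix.Norms.Operator ContDiff Topology TensorProduct Classical Matrix ComplexConjugate
open Filter NumberField NumberField.mixedEmbedding
open Literature.NumberTheory.Automorphic Literature.NumberTheory.Automorphic.RealMatrixGroup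
  Literature.NumberTheory.Automorphic.ConeDictionary

-- Same instance context as the c8 file `…ResConeAnalytic` (whose lemmas are used throughout) and as the
-- registered signature: calculus of FORM-valued maps on `M_n(K_∞)` along ONE topology, the operator
-- norm `Matrix.Norms.Operator`; the product-topology instances are removed, and the derived normed
-- structures on `hermSpace n K →L[ℝ] _` are found along the `NormedAddCommGroup` instance of `hermSpace`.
attribute [-instance] instTopologicalSpaceMatrix
attribute [-instance] Matrix.instUniformSpace
attribute [local instance high] NormedAddCommGroup.toSeminormedAddCommGroup

namespace Summit.Langlands.Langlands.Theorems.HeckeEigenvalueField.Res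

section ConeDerivative

variable {n : ℕ} {K : Type} [Field K] [NumberField K] {hcpt : isCompact_glFiniteIntegralLevel n K}
  (π : AutomorphicRepData (AutomorphyDatum.gl n K hcpt))
  (S : Finset {w : InfinitePlace K // w.IsReal}) (lam : (K →+* ℂ) → Fin n → ℤ) {q : ℕ}

omit [NumberField K] in
/-- `Y mᴴ + m Yᴴ` is hermitian. [folklore] -/
theorem cfg_tangent_herm [NumberField K] (m Y : Matrix (Fin n) (Fin n) (mixedSpace K)) :
    (Y * mᴴ + m * Yᴴ)ᴴ = Y * mᴴ + m * Yᴴ := by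
  rw [Matrix.conjTranspose_add, Matrix.conjTranspose_mul, Matrix.conjTranspose_mul,
    Matrix.conjTranspose_conjTranspose, Matrix.conjTranspose_conjTranspose, add_comm]

/-- **The hermitian projection `P m = ½(m + mᴴ)` and the differential `T m : Y ↦ P(Y mᴴ + m Yᴴ)` of
the hermitian square `m ↦ m mᴴ`, as continuous linear maps over the operator-norm topology.**
[folklore] -/
theorem cfg_exists_proj_tangent (n : ℕ) (K : Type) [Field K] [NumberField K] :
    ∃ (Pr : Matrix (Fin n) (Fin n) (mixedSpace K) →L[ℝ] ResGLnCone.hermSpace n K)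
      (TT : Matrix (Fin n) (Fin n) (mixedSpace K) →L[ℝ]
        (Matrix (Fin n) (Fin n) (mixedSpace K) →L[ℝ] ResGLnCone.hermSpace n K)),
      (∀ m : Matrix (Fin n) (Fin n) (mixedSpace K), mᴴ = m →
        ((Pr m : ResGLnCone.hermSpace n K) : Matrix (Fin n) (Fin n) (mixedSpace K)) = m) ∧
      ∀ m Y, TT m Y = Pr (Y * mᴴ + m * Yᴴ) := by
  let Pₗ : Matrix (Fin n) (Fin n) (mixedSpace K) →ₗ[ℝ] ResGLnCone.hermSpace n K :=
    { toFun := fun m => ⟨(1 / 2 : ℝ) • (m + mᴴ), by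
        rw [ResGLnCone.mem_hermSpace_iff, Matrix.conjTranspose_smul, Matrix.conjTranspose_add,
          Matrix.conjTranspose_conjTranspose, star_trivial, add_comm]⟩
      map_add' := fun m m' => Subtype.ext (by
        simp only [Submodule.coe_add, Matrix.conjTranspose_add, ← smul_add]
        congr 1
        abel)
      map_smul' := fun c m => Subtype.ext (by
        simp only [Submodule.coe_smul, RingHom.id_apply, Matrix.conjTranspose_smul, star_trivial,
          ← smul_add]
        rw [smul_comm]) }
  let Pr : Matrix (Fin n) (Fin n) (mixedSpace K) →L[ℝ] ResGLnCone.hermSpace n K :=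
    LinearMap.toContinuousLinearMap Pₗ
  let Λ : Matrix (Fin n) (Fin n) (mixedSpace K) →L[ℝ]
      (Matrix (Fin n) (Fin n) (mixedSpace K) →L[ℝ] Matrix (Fin n) (Fin n) (mixedSpace K)) :=
    ((ContinuousLinearMap.mul ℝ (Matrix (Fin n) (Fin n) (mixedSpace K))).flip).comp conjTransposeL +
      ((ContinuousLinearMap.compL ℝ (Matrix (Fin n) (Fin n) (mixedSpace K)) (Matrix (Fin n) (Fin n) (mixedSpace K))
        (Matrix (Fin n) (Fin n) (mixedSpace K))).flip conjTransposeL).comp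
        (ContinuousLinearMap.mul ℝ (Matrix (Fin n) (Fin n) (mixedSpace K)))
  have hΛ : ∀ m Y, Λ m Y = Y * mᴴ + m * Yᴴ := fun m Y => rfl
  refine ⟨Pr, (ContinuousLinearMap.compL ℝ (Matrix (Fin n) (Fin n) (mixedSpace K))
    (Matrix (Fin n) (Fin n) (mixedSpace K)) (ResGLnCone.hermSpace n K) Pr).comp Λ, fun m hm => ?_, fun m Y => ?_⟩
  · show (1 / 2 : ℝ) • (m + mᴴ) = m
    rw [hm, ← two_smul ℝ m, smul_smul]
    norm_num
  · show Pr (Λ m Y) = Pr (Y * mᴴ + m * Yᴴ)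
    rw [hΛ]

set_option maxHeartbeats 800000 in
-- the pullback identity is instantiated at every invertible matrix near `g` (abbrev towers over the datum)
/-- **The derivative of the cone form at `H = g gᴴ` through the group.**  Near the invertible `g`
the left-trivialised form is the pullback `ω̃(m) = ω(P(m mᴴ)) ∘∧ T(m)` of the cone form along the
hermitian square (`coneForm_apply_tangent` at every invertible `m`); differentiating at `g`
(`ω` is differentiable at `H`, `differentiableAt_coneForm`), evaluating at `R w = ½ w g⁻ᴴ` — a right
inverse of `T(g)` on the hermitian space — and composing with `R`:
`Dω_H(w) = Dω̃_g(R w) ∘∧ R − ((ω H) ∘' T(g)) (T (R w)) ∘∧ R`. [cite: BorelWallach2000, VII 2.2–2.4] -/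
theorem cfg_fderiv_coneForm_apply {η : ConeDictionary.Cochain π lam (q + 1)}
    (hη : η ∈ (gkComplexLS π S lam).carrier (q + 1)) (c : BigHeckeGLn.FiniteAdelicGL n K)
    (Pr : Matrix (Fin n) (Fin n) (mixedSpace K) →L[ℝ] ResGLnCone.hermSpace n K)
    (hPr : ∀ m : Matrix (Fin n) (Fin n) (mixedSpace K), mᴴ = m →
      ((Pr m : ResGLnCone.hermSpace n K) : Matrix (Fin n) (Fin n) (mixedSpace K)) = m)
    (TT : Matrix (Fin n) (Fin n) (mixedSpace K) →L[ℝ]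
      (Matrix (Fin n) (Fin n) (mixedSpace K) →L[ℝ] ResGLnCone.hermSpace n K))
    (hTT : ∀ m Y, TT m Y = Pr (Y * mᴴ + m * Yᴴ))
    {H : ResGLnCone.hermSpace n K} (hH : H ∈ ResGLnCone.posCone n K)
    {g : Matrix (Fin n) (Fin n) (mixedSpace K)} (hu : IsUnit g)
    (hg : g * gᴴ = (H : Matrix (Fin n) (Fin n) (mixedSpace K)))
    (R : ResGLnCone.hermSpace n K →L[ℝ] Matrix (Fin n) (Fin n) (mixedSpace K))
    (hR : ∀ w, R w = (1 / 2 : ℝ) • ((w : Matrix (Fin n) (Fin n) (mixedSpace K)) * (Ring.inverse g)ᴴ))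
    (w : ResGLnCone.hermSpace n K) :
    fderiv ℝ (fun H => @id (ResGLnCone.hermSpace n K [⋀^Fin (q + 1)]→L[ℝ] ResGLnCohomology.CoeffModule ℂ n K lam)
        (coneForm π S lam η c H)) H w =
      (fderiv ℝ (leftTrivFormN π S lam η c) g (R w)).compContinuousLinearMap R -
        (((@id (ResGLnCone.hermSpace n K [⋀^Fin (q + 1)]→L[ℝ] ResGLnCohomology.CoeffModule ℂ n K lam)
          (coneForm π S lam η c H)).fderivCompContinuousLinearMap (TT g)) (TT (R w))).compContinuousLinearMap R := by
  let ωf : ResGLnCone.hermSpace n K →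
      ResGLnCone.hermSpace n K [⋀^Fin (q + 1)]→L[ℝ] ResGLnCohomology.CoeffModule ℂ n K lam :=
    fun H => @id (ResGLnCone.hermSpace n K [⋀^Fin (q + 1)]→L[ℝ] ResGLnCohomology.CoeffModule ℂ n K lam)
      (coneForm π S lam η c H)
  have hgi : g * Ring.inverse g = 1 := Ring.mul_inverse_cancel g hu
  have hRinv : ∀ w : ResGLnCone.hermSpace n K,
      R w * gᴴ + g * (R w)ᴴ = (w : Matrix (Fin n) (Fin n) (mixedSpace K)) := by
    intro w
    rw [hR, smul_mul_assoc, Matrix.mul_assoc, ← Matrix.conjTranspose_mul, hgi, Matrix.conjTranspose_one,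
      Matrix.mul_one, Matrix.conjTranspose_smul, star_trivial, Matrix.mul_smul, Matrix.conjTranspose_mul,
      Matrix.conjTranspose_conjTranspose, ← Matrix.mul_assoc, hgi, Matrix.one_mul,
      show ((w : ResGLnCone.hermSpace n K) : Matrix (Fin n) (Fin n) (mixedSpace K))ᴴ = w from w.2, ← add_smul]
    norm_num
  have hTTR : ∀ w : ResGLnCone.hermSpace n K, TT g (R w) = w := fun w => by
    rw [hTT, hRinv]
    exact Subtype.ext (hPr _ w.2)
  have hPgg : Pr (g * gᴴ) = H :=
    Subtype.ext ((hPr _ (by rw [Matrix.conjTranspose_mul, Matrix.conjTranspose_conjTranspose])).trans hg)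
  have hI : ∀ m : Matrix (Fin n) (Fin n) (mixedSpace K), IsUnit m →
      leftTrivFormN π S lam η c m = (ωf (Pr (m * mᴴ))).compContinuousLinearMap (TT m) := by
    intro m hm
    have hcoe : (((GLn.archOfMatrix n K m : (AutomorphyDatum.gl n K hcpt).arch.carrier) :
        GL (Fin n) (mixedSpace K)) : Matrix (Fin n) (Fin n) (mixedSpace K)) = m := GLn.coe_archOfMatrix hm
    have hPm : ((Pr (m * mᴴ) : ResGLnCone.hermSpace n K) : Matrix (Fin n) (Fin n) (mixedSpace K)) = m * mᴴ :=
      hPr _ (by rw [Matrix.conjTranspose_mul, Matrix.conjTranspose_conjTranspose])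
    ext Y
    rw [ContinuousAlternatingMap.compContinuousLinearMap_apply]
    have key := coneForm_apply_tangent π S lam hη c (GLn.archOfMatrix n K m) (H := Pr (m * mᴴ))
      (by rw [hcoe]; exact hPm.symm) Y (fun i => TT m (Y i))
      (fun i => by rw [hcoe, hTT]; exact hPr _ (cfg_tangent_herm m (Y i)))
    rw [hcoe] at key
    exact key.symm
  have hev : leftTrivFormN π S lam η c =ᶠ[𝓝 g] fun m => (ωf (Pr (m * mᴴ))).compContinuousLinearMap (TT m) := by
    filter_upwards [Units.isOpen.mem_nhds hu] with m hm using hI m hm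
  have hω : HasFDerivAt ωf (fderiv ℝ ωf H) H := (differentiableAt_coneForm π S lam hη c hH).hasFDerivAt
  have hω' : HasFDerivAt ωf (fderiv ℝ ωf H) (Pr (g * gᴴ)) := by rw [hPgg]; exact hω
  have hsq : HasFDerivAt (fun m : Matrix (Fin n) (Fin n) (mixedSpace K) => m * mᴴ)
      (g • (conjTransposeL (n := n) (K := K)) +
        MulOpposite.op gᴴ • ContinuousLinearMap.id ℝ (Matrix (Fin n) (Fin n) (mixedSpace K))) g :=
    (hasFDerivAt_id g).mul' (conjTransposeL (n := n) (K := K)).hasFDerivAt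
  have hA := (hω'.comp (g * gᴴ) Pr.hasFDerivAt).comp g hsq
  have hF := hA.continuousAlternatingMapCompContinuousLinearMap TT.hasFDerivAt
  have hΦ := hF.congr_of_eventuallyEq hev
  have h1 : fderiv ℝ (leftTrivFormN π S lam η c) g (R w) =
      (fderiv ℝ ωf H w).compContinuousLinearMap (TT g) +
        ((ωf H).fderivCompContinuousLinearMap (TT g)) (TT (R w)) := by
    rw [hΦ.fderiv, _root_.add_apply, ContinuousLinearMap.comp_apply, ContinuousLinearMap.comp_apply,
      ContinuousAlternatingMap.compContinuousLinearMapCLM_apply]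
    have hD : Pr ((g • (conjTransposeL (n := n) (K := K)) +
        MulOpposite.op gᴴ • ContinuousLinearMap.id ℝ (Matrix (Fin n) (Fin n) (mixedSpace K))) (R w)) = w := by
      change Pr (g * (R w)ᴴ + R w * gᴴ) = w
      rw [add_comm, hRinv]
      exact Subtype.ext (hPr _ w.2)
    simp only [Function.comp_apply, ContinuousLinearMap.coe_comp, hD, hPgg]
  have h2 : ((fderiv ℝ ωf H w).compContinuousLinearMap (TT g)).compContinuousLinearMap R = fderiv ℝ ωf H w := by
    ext v
    simp only [ContinuousAlternatingMap.compContinuousLinearMap_apply, Function.comp_def, hTTR]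
  have h3 : (fderiv ℝ (leftTrivFormN π S lam η c) g (R w)).compContinuousLinearMap R =
      fderiv ℝ ωf H w + (((ωf H).fderivCompContinuousLinearMap (TT g)) (TT (R w))).compContinuousLinearMap R := by
    rw [h1, ← ContinuousAlternatingMap.compContinuousLinearMapCLM_apply, map_add,
      ContinuousAlternatingMap.compContinuousLinearMapCLM_apply,
      ContinuousAlternatingMap.compContinuousLinearMapCLM_apply, h2]
  exact eq_sub_of_add_eq h3.symm

end ConeDerivative

section Final

set_option maxHeartbeats 800000 in
-- unfolding of the cone form at vectors and the derivative formula at one point of the cone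
/-- **Registered sub-goal (part 4 of stub `stub_coneForm_growth`): pointwise bounds at `H ∈` the cone** in terms of a single quantity `t ≥ 1` dominating
`‖ω_left(g)‖`, `‖Dω_left(g)‖`, `‖g‖`, `‖g⁻¹‖`, `‖g⁻ᴴ‖` (`g = sec H`) and the two fixed operator
norms `‖ι‖` (hermitian inclusion) and `‖T‖` (tangent map): `‖ω(H)‖ ≤ t^{3q+4}` and
`‖Dω(H)‖ ≤ (2q + 3) t^{7q+9}` (`ω(H) = ω_left(g) ∘∧ (g⁻¹ ·) ∘∧ R`, `R = ½(·)g⁻ᴴ`, and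
`cfg_fderiv_coneForm_apply`). [cite: BorelWallach2000, VII 2.2–2.4] -/
theorem stub_coneGrowth_pointwise {n : ℕ} {K : Type} [Field K] [NumberField K]
    {hcpt : isCompact_glFiniteIntegralLevel n K} (π : AutomorphicRepData (AutomorphyDatum.gl n K hcpt))
    (S : Finset {w : InfinitePlace K // w.IsReal}) (lam : (K →+* ℂ) → Fin n → ℤ) {q : ℕ}
    {η : ConeDictionary.Cochain π lam (q + 1)}
    (hη : η ∈ (gkComplexLS π S lam).carrier (q + 1)) (c : BigHeckeGLn.FiniteAdelicGL n K)
    (Pr : Matrix (Fin n) (Fin n) (mixedSpace K) →L[ℝ] ResGLnCone.hermSpace n K)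
    (hPr : ∀ m : Matrix (Fin n) (Fin n) (mixedSpace K), mᴴ = m →
      ((Pr m : ResGLnCone.hermSpace n K) : Matrix (Fin n) (Fin n) (mixedSpace K)) = m)
    (TT : Matrix (Fin n) (Fin n) (mixedSpace K) →L[ℝ]
      (Matrix (Fin n) (Fin n) (mixedSpace K) →L[ℝ] ResGLnCone.hermSpace n K))
    (hTT : ∀ m Y, TT m Y = Pr (Y * mᴴ + m * Yᴴ))
    {H : ResGLnCone.hermSpace n K} (hH : H ∈ ResGLnCone.posCone n K)
    {g : Matrix (Fin n) (Fin n) (mixedSpace K)} (hgsec : sec n K H = g) {t : ℝ} (ht1 : 1 ≤ t)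
    (hA : ‖leftFormN π S lam η c g‖ ≤ t) (hB : ‖fderiv ℝ (leftFormN π S lam η c) g‖ ≤ t)
    (hsg : ‖g‖ ≤ t) (hsi : ‖Ring.inverse g‖ ≤ t) (hsiH : ‖(Ring.inverse g)ᴴ‖ ≤ t)
    (hι : ‖(hermIncl : ResGLnCone.hermSpace n K →L[ℝ] Matrix (Fin n) (Fin n) (mixedSpace K))‖ ≤ t) (hT : ‖TT‖ ≤ t) :
    ‖@id (ResGLnCone.hermSpace n K [⋀^Fin (q + 1)]→L[ℝ] ResGLnCohomology.CoeffModule ℂ n K lam)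
        (coneForm π S lam η c H)‖ ≤ t ^ (3 * q + 4) ∧
    ‖fderiv ℝ (fun H => @id (ResGLnCone.hermSpace n K [⋀^Fin (q + 1)]→L[ℝ] ResGLnCohomology.CoeffModule ℂ n K lam)
        (coneForm π S lam η c H)) H‖ ≤ (2 * q + 3) * t ^ (7 * q + 9) := by
  obtain ⟨hu, hgH⟩ := sec_spec (exists_isUnit_mul_conjTranspose_eq_of_mem_posCone hH)
  rw [hgsec] at hu hgH
  obtain ⟨u, hug⟩ := hu
  have ht0 : 0 ≤ t := zero_le_one.trans ht1
  have hpow : ∀ {a b : ℕ}, a ≤ b → t ^ a ≤ t ^ b := fun hab => pow_le_pow_right₀ ht1 hab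
  let R : ResGLnCone.hermSpace n K →L[ℝ] Matrix (Fin n) (Fin n) (mixedSpace K) :=
    (1 / 2 : ℝ) • (((ContinuousLinearMap.mul ℝ (Matrix (Fin n) (Fin n) (mixedSpace K))).flip
      (Ring.inverse g)ᴴ).comp hermIncl)
  have hR : ∀ w, R w = (1 / 2 : ℝ) • ((w : Matrix (Fin n) (Fin n) (mixedSpace K)) * (Ring.inverse g)ᴴ) :=
    fun w => rfl
  have hRn : ‖R‖ ≤ t ^ 2 := by
    refine ContinuousLinearMap.opNorm_le_bound _ (by positivity) fun w => ?_
    rw [hR, _root_.norm_smul]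
    have hw : ‖(w : Matrix (Fin n) (Fin n) (mixedSpace K))‖ ≤ t * ‖w‖ :=
      ((hermIncl (n := n) (K := K)).le_opNorm w).trans (mul_le_mul_of_nonneg_right hι (norm_nonneg _))
    calc ‖(1 / 2 : ℝ)‖ * ‖(w : Matrix (Fin n) (Fin n) (mixedSpace K)) * (Ring.inverse g)ᴴ‖
        ≤ 1 * (‖(w : Matrix (Fin n) (Fin n) (mixedSpace K))‖ * ‖(Ring.inverse g)ᴴ‖) :=
          mul_le_mul (by norm_num) (norm_mul_le _ _) (norm_nonneg _) zero_le_one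
      _ ≤ 1 * ((t * ‖w‖) * t) :=
          mul_le_mul_of_nonneg_left (mul_le_mul hw hsiH (norm_nonneg _) (by positivity)) zero_le_one
      _ = t ^ 2 * ‖w‖ := by ring
  have hω0 : ‖@id (ResGLnCone.hermSpace n K [⋀^Fin (q + 1)]→L[ℝ] ResGLnCohomology.CoeffModule ℂ n K lam)
      (coneForm π S lam η c H)‖ ≤ t ^ (3 * q + 4) := by
    refine ContinuousAlternatingMap.opNorm_le_bound _ (by positivity) fun v => ?_
    have e : @id (ResGLnCone.hermSpace n K [⋀^Fin (q + 1)]→L[ℝ] ResGLnCohomology.CoeffModule ℂ n K lam)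
        (coneForm π S lam η c H) v = leftFormN π S lam η c g fun i => Ring.inverse g * R (v i) := by
      show coneForm π S lam η c H v = leftForm π S lam η c g fun i => Ring.inverse g * R (v i)
      rw [coneForm_apply, leftTrivForm_apply, hgsec]
      simp only [halfRight_apply, hR]
    rw [e]
    refine ((leftFormN π S lam η c g).le_opNorm _).trans ?_
    have hY : ∀ i, ‖Ring.inverse g * R (v i)‖ ≤ t ^ 3 * ‖v i‖ := fun i =>
      calc ‖Ring.inverse g * R (v i)‖ ≤ ‖Ring.inverse g‖ * ‖R (v i)‖ := norm_mul_le _ _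
        _ ≤ t * (t ^ 2 * ‖v i‖) :=
            mul_le_mul hsi ((R.le_opNorm _).trans (mul_le_mul_of_nonneg_right hRn (norm_nonneg _)))
              (norm_nonneg _) ht0
        _ = t ^ 3 * ‖v i‖ := by ring
    calc ‖leftFormN π S lam η c g‖ * ∏ i, ‖Ring.inverse g * R (v i)‖
        ≤ t * ∏ i, (t ^ 3 * ‖v i‖) :=
          mul_le_mul hA (Finset.prod_le_prod (fun i _ => norm_nonneg _) fun i _ => hY i)
            (Finset.prod_nonneg fun i _ => norm_nonneg _) ht0
      _ = t ^ (3 * q + 4) * ∏ i, ‖v i‖ := by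
          rw [Finset.prod_mul_distrib, Finset.prod_const, Finset.card_univ, Fintype.card_fin, ← pow_mul]
          ring
  refine ⟨hω0, ?_⟩
  have hmul : ‖ContinuousLinearMap.mul ℝ (Matrix (Fin n) (Fin n) (mixedSpace K)) (Ring.inverse g)‖ ≤ t :=
    (ContinuousLinearMap.opNorm_mul_apply_le _ _ _).trans hsi
  have hD₂ : ‖fderiv ℝ (fun m : Matrix (Fin n) (Fin n) (mixedSpace K) =>
      ContinuousLinearMap.mul ℝ (Matrix (Fin n) (Fin n) (mixedSpace K)) (Ring.inverse m)) g‖ ≤ t ^ 2 := by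
    have hri : HasFDerivAt Ring.inverse (-((ContinuousLinearMap.mulLeftRight ℝ (Matrix (Fin n) (Fin n) (mixedSpace K)))
        ((u⁻¹ : (Matrix (Fin n) (Fin n) (mixedSpace K))ˣ) : Matrix (Fin n) (Fin n) (mixedSpace K)))
        ((u⁻¹ : (Matrix (Fin n) (Fin n) (mixedSpace K))ˣ) : Matrix (Fin n) (Fin n) (mixedSpace K))) g := by
      rw [← hug]
      exact hasFDerivAt_ringInverse u
    have h := ((ContinuousLinearMap.mul ℝ (Matrix (Fin n) (Fin n) (mixedSpace K))).hasFDerivAt.comp g hri).fderiv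
    rw [show (⇑(ContinuousLinearMap.mul ℝ (Matrix (Fin n) (Fin n) (mixedSpace K))) ∘ Ring.inverse) =
      fun m => ContinuousLinearMap.mul ℝ (Matrix (Fin n) (Fin n) (mixedSpace K)) (Ring.inverse m) from rfl] at h
    rw [h]
    refine (ContinuousLinearMap.opNorm_comp_le _ _).trans ?_
    rw [norm_neg]
    have hinv : ((u⁻¹ : (Matrix (Fin n) (Fin n) (mixedSpace K))ˣ) : Matrix (Fin n) (Fin n) (mixedSpace K)) =
        Ring.inverse g := by rw [← hug, Ring.inverse_unit]
    rw [hinv]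
    calc ‖ContinuousLinearMap.mul ℝ (Matrix (Fin n) (Fin n) (mixedSpace K))‖ *
          ‖ContinuousLinearMap.mulLeftRight ℝ (Matrix (Fin n) (Fin n) (mixedSpace K)) (Ring.inverse g) (Ring.inverse g)‖
        ≤ 1 * (‖Ring.inverse g‖ * ‖Ring.inverse g‖) :=
          mul_le_mul (ContinuousLinearMap.opNorm_mul_le _ _)
            (ContinuousLinearMap.opNorm_mulLeftRight_apply_apply_le _ _ _ _) (norm_nonneg _) zero_le_one
      _ ≤ 1 * (t * t) := mul_le_mul_of_nonneg_left (mul_le_mul hsi hsi (norm_nonneg _) ht0) zero_le_one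
      _ = t ^ 2 := by ring
  have hDΦ : ‖fderiv ℝ (leftTrivFormN π S lam η c) g‖ ≤ (q + 2) * t ^ (q + 3) := by
    have hug' : IsUnit g := ⟨u, hug⟩
    rw [show leftTrivFormN π S lam η c = fun m => (leftFormN π S lam η c m).compContinuousLinearMap
      (ContinuousLinearMap.mul ℝ (Matrix (Fin n) (Fin n) (mixedSpace K)) (Ring.inverse m)) from rfl,
      fderiv_continuousAlternatingMapCompContinuousLinearMap (differentiableAt_leftForm π S lam η c hug')
        (differentiableAt_mul_inverse hug')]
    refine ContinuousLinearMap.opNorm_le_bound _ (by positivity) fun Z => ?_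
    rw [_root_.add_apply, ContinuousLinearMap.comp_apply, ContinuousLinearMap.comp_apply,
      ContinuousAlternatingMap.compContinuousLinearMapCLM_apply]
    refine (norm_add_le _ _).trans ?_
    have h1 : ‖(fderiv ℝ (leftFormN π S lam η c) g Z).compContinuousLinearMap
        (ContinuousLinearMap.mul ℝ (Matrix (Fin n) (Fin n) (mixedSpace K)) (Ring.inverse g))‖ ≤
        t ^ (q + 2) * ‖Z‖ :=
      calc _ ≤ ‖fderiv ℝ (leftFormN π S lam η c) g Z‖ *
            ‖ContinuousLinearMap.mul ℝ (Matrix (Fin n) (Fin n) (mixedSpace K)) (Ring.inverse g)‖ ^ (q + 1) := by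
              have := ContinuousAlternatingMap.norm_compContinuousLinearMap_le
                (fderiv ℝ (leftFormN π S lam η c) g Z)
                (ContinuousLinearMap.mul ℝ (Matrix (Fin n) (Fin n) (mixedSpace K)) (Ring.inverse g))
              rwa [Fintype.card_fin] at this
        _ ≤ (t * ‖Z‖) * t ^ (q + 1) :=
              mul_le_mul (((fderiv ℝ (leftFormN π S lam η c) g).le_opNorm Z).trans
                (mul_le_mul_of_nonneg_right hB (norm_nonneg _)))
                (pow_le_pow_left₀ (norm_nonneg _) hmul _) (by positivity) (by positivity)
        _ = t ^ (q + 2) * ‖Z‖ := by ring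
    have h2 : ‖((leftFormN π S lam η c g).fderivCompContinuousLinearMap
        (ContinuousLinearMap.mul ℝ (Matrix (Fin n) (Fin n) (mixedSpace K)) (Ring.inverse g)))
        (fderiv ℝ (fun m : Matrix (Fin n) (Fin n) (mixedSpace K) =>
          ContinuousLinearMap.mul ℝ (Matrix (Fin n) (Fin n) (mixedSpace K)) (Ring.inverse m)) g Z)‖ ≤
        (q + 1) * t ^ (q + 3) * ‖Z‖ :=
      calc _ ≤ ‖(leftFormN π S lam η c g).fderivCompContinuousLinearMap
            (ContinuousLinearMap.mul ℝ (Matrix (Fin n) (Fin n) (mixedSpace K)) (Ring.inverse g))‖ *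
            ‖fderiv ℝ (fun m : Matrix (Fin n) (Fin n) (mixedSpace K) =>
              ContinuousLinearMap.mul ℝ (Matrix (Fin n) (Fin n) (mixedSpace K)) (Ring.inverse m)) g Z‖ :=
              ContinuousLinearMap.le_opNorm _ _
        _ ≤ ((q + 1) * t ^ q * t) * (t ^ 2 * ‖Z‖) := by
              refine mul_le_mul ((cfg_norm_fderivCompCLM_le _ _).trans ?_)
                ((ContinuousLinearMap.le_opNorm _ _).trans (mul_le_mul_of_nonneg_right hD₂ (norm_nonneg _)))
                (norm_nonneg _) (by positivity)
              exact mul_le_mul (mul_le_mul_of_nonneg_left (pow_le_pow_left₀ (norm_nonneg _) hmul _) (by positivity))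
                hA (norm_nonneg _) (by positivity)
        _ = (q + 1) * t ^ (q + 3) * ‖Z‖ := by ring
    calc _ ≤ t ^ (q + 2) * ‖Z‖ + (q + 1) * t ^ (q + 3) * ‖Z‖ := add_le_add h1 h2
      _ ≤ t ^ (q + 3) * ‖Z‖ + (q + 1) * t ^ (q + 3) * ‖Z‖ := by
          have := mul_le_mul_of_nonneg_right (hpow (show q + 2 ≤ q + 3 by omega)) (norm_nonneg Z)
          linarith
      _ = (q + 2) * t ^ (q + 3) * ‖Z‖ := by ring
  have hTg : ‖TT g‖ ≤ t ^ 2 :=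
    calc ‖TT g‖ ≤ ‖TT‖ * ‖g‖ := TT.le_opNorm g
      _ ≤ t * t := mul_le_mul hT hsg (norm_nonneg _) ht0
      _ = t ^ 2 := by ring
  have hfdc : ‖(@id (ResGLnCone.hermSpace n K [⋀^Fin (q + 1)]→L[ℝ] ResGLnCohomology.CoeffModule ℂ n K lam)
      (coneForm π S lam η c H)).fderivCompContinuousLinearMap (TT g)‖ ≤ (q + 1) * t ^ (5 * q + 4) :=
    calc _ ≤ (q + 1) * ‖TT g‖ ^ q * ‖@id (ResGLnCone.hermSpace n K [⋀^Fin (q + 1)]→L[ℝ]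
            ResGLnCohomology.CoeffModule ℂ n K lam) (coneForm π S lam η c H)‖ := cfg_norm_fderivCompCLM_le _ _
      _ ≤ (q + 1) * (t ^ 2) ^ q * t ^ (3 * q + 4) :=
          mul_le_mul (mul_le_mul_of_nonneg_left (pow_le_pow_left₀ (norm_nonneg _) hTg _) (by positivity)) hω0
            (norm_nonneg _) (by positivity)
      _ = (q + 1) * t ^ (5 * q + 4) := by
          rw [← pow_mul, mul_assoc, ← pow_add]
          congr 2
          ring
  refine ContinuousLinearMap.opNorm_le_bound _ (by positivity) fun w => ?_
  rw [cfg_fderiv_coneForm_apply π S lam hη c Pr hPr TT hTT hH ⟨u, hug⟩ hgH R hR w]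
  refine (norm_sub_le _ _).trans ?_
  have hRq : ‖R‖ ^ (q + 1) ≤ t ^ (2 * q + 2) := by
    rw [show 2 * q + 2 = 2 * (q + 1) by ring, pow_mul]
    exact pow_le_pow_left₀ (norm_nonneg _) hRn _
  have e1 : ‖(fderiv ℝ (leftTrivFormN π S lam η c) g (R w)).compContinuousLinearMap R‖ ≤
      (q + 2) * t ^ (3 * q + 7) * ‖w‖ :=
    calc _ ≤ ‖fderiv ℝ (leftTrivFormN π S lam η c) g (R w)‖ * ‖R‖ ^ (q + 1) := by
          have := ContinuousAlternatingMap.norm_compContinuousLinearMap_le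
            (fderiv ℝ (leftTrivFormN π S lam η c) g (R w)) R
          rwa [Fintype.card_fin] at this
      _ ≤ ((q + 2) * t ^ (q + 3) * (t ^ 2 * ‖w‖)) * t ^ (2 * q + 2) :=
          mul_le_mul ((((fderiv ℝ (leftTrivFormN π S lam η c) g).le_opNorm (R w)).trans
            (mul_le_mul hDΦ ((R.le_opNorm w).trans (mul_le_mul_of_nonneg_right hRn (norm_nonneg _)))
              (norm_nonneg _) (by positivity)))) hRq (by positivity) (by positivity)
      _ = (q + 2) * t ^ (3 * q + 7) * ‖w‖ := by ring
  have e2 : ‖(((@id (ResGLnCone.hermSpace n K [⋀^Fin (q + 1)]→L[ℝ] ResGLnCohomology.CoeffModule ℂ n K lam)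
      (coneForm π S lam η c H)).fderivCompContinuousLinearMap (TT g)) (TT (R w))).compContinuousLinearMap R‖ ≤
      (q + 1) * t ^ (7 * q + 9) * ‖w‖ :=
    calc _ ≤ ‖((@id (ResGLnCone.hermSpace n K [⋀^Fin (q + 1)]→L[ℝ] ResGLnCohomology.CoeffModule ℂ n K lam)
            (coneForm π S lam η c H)).fderivCompContinuousLinearMap (TT g)) (TT (R w))‖ * ‖R‖ ^ (q + 1) := by
          have := ContinuousAlternatingMap.norm_compContinuousLinearMap_le
            (((@id (ResGLnCone.hermSpace n K [⋀^Fin (q + 1)]→L[ℝ] ResGLnCohomology.CoeffModule ℂ n K lam)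
              (coneForm π S lam η c H)).fderivCompContinuousLinearMap (TT g)) (TT (R w))) R
          rwa [Fintype.card_fin] at this
      _ ≤ (((q + 1) * t ^ (5 * q + 4)) * (t * (t ^ 2 * ‖w‖))) * t ^ (2 * q + 2) := by
          refine mul_le_mul ?_ hRq (by positivity) (by positivity)
          refine (ContinuousLinearMap.le_opNorm _ _).trans (mul_le_mul hfdc ?_ (norm_nonneg _) (by positivity))
          exact (TT.le_opNorm _).trans (mul_le_mul hT ((R.le_opNorm w).trans
            (mul_le_mul_of_nonneg_right hRn (norm_nonneg _))) (norm_nonneg _) ht0)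
      _ = (q + 1) * t ^ (7 * q + 9) * ‖w‖ := by ring
  calc _ ≤ (q + 2) * t ^ (3 * q + 7) * ‖w‖ + (q + 1) * t ^ (7 * q + 9) * ‖w‖ := add_le_add e1 e2
    _ ≤ (q + 2) * t ^ (7 * q + 9) * ‖w‖ + (q + 1) * t ^ (7 * q + 9) * ‖w‖ := by
        have h := hpow (show 3 * q + 7 ≤ 7 * q + 9 by omega)
        have : (q + 2 : ℝ) * t ^ (3 * q + 7) * ‖w‖ ≤ (q + 2) * t ^ (7 * q + 9) * ‖w‖ :=
          mul_le_mul_of_nonneg_right (mul_le_mul_of_nonneg_left h (by positivity)) (norm_nonneg _)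
        linarith
    _ = (2 * q + 3) * t ^ (7 * q + 9) * ‖w‖ := by ring

end Final

end Summit.Langlands.Langlands.Theorems.HeckeEigenvalueField.Res

end
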